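import Literature.MathematicalPhysics.KineticTheory.HardSphereEuler
import HarnessLib

/-!
# The coherent/incoherent split of the suprathermal heat flux (stub `stub_hiHeatFluxSplit`, line
# `IdeatorTwoSketch`, crux `ClampedCurrentsDock`, stmt-AtomisticToContinuum-14680)

Helper file (`--supports stmt-AtomisticToContinuum-14680`) proving the registered stub
`stub_hiHeatFluxSplit : HiHeatFluxSplit` of the lead's skeleton (`Cruxes/ClampedCurrentsDock/Lines/IdeatorTwoSketch.lean`):
the deterministic bridge between the cubic channel of Yau's entropy ledger and the integrand of the line's true-law
input `CoherentSuprathermalContentVanishes` (card `coherence-not-tails`). Pure real analysis on a window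
`[s, s+w]`: each signal is either INCOHERENT (its window-integrated suprathermal flux is at most `η` times its cubic
content — paid at rate `η`) or COHERENT (paid by its suprathermal cubic content, since pointwise
`‖1{K<‖W‖}(‖W‖² − 5ϑ)W‖ ≤ (1 + 5θmax/K²)·1{K<‖W‖}‖W‖³`).
-/

noncomputable section

namespace Summit.AtomisticToContinuum.HydrodynamicLimit.Theorems.ClampedCurrentsDockHiSplit

open MeasureTheory Filter Set Topology Finset
open scoped Interval
open Literature.MathematicalPhysics.KineticTheory Literature.Analysis.FluidPDE Literature.Analysis.FunctionSpaces

/-- **S12 — the coherent/incoherent split of the suprathermal heat flux (pure real analysis; worker-sized).** On a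
window `[s, s+w]`, for finitely many measurable peculiar-velocity signals `W_i : ℝ → ℝ³` with integrable cubes, local
temperatures `|ϑ_i| ≤ θmax`, frozen weights `β_i ∈ ℝ³` with `‖β_i‖ ≤ B`, a cut-off `K > 0` and a coherence level
`η > 0`: with the suprathermal flux signal `Q_i(r) = 1{K < ‖W_i(r)‖}(‖W_i(r)‖² − 5ϑ_i(r)) W_i(r)`,
`|Σ_i β_i · ∫_s^{s+w} Q_i| ≤ B [η Σ_i ∫‖W_i‖³ + (1 + 5θmax/K²) Σ_{i coherent} ∫ 1{K < ‖W_i‖}‖W_i‖³]`,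
where `i` is COHERENT iff `η ∫‖W_i‖³ < ‖∫ Q_i‖` (incoherent signals are paid by their cubic content at rate `η`,
coherent ones by their suprathermal cubic content — the integrand of S6 up to the `w⁻¹` normalisations). -/
def HiHeatFluxSplit : Prop :=
  ∀ (n : ℕ) (s w K η θmax B : ℝ) (W : Fin n → ℝ → V3) (ϑ : Fin n → ℝ → ℝ) (β : Fin n → V3),
    0 ≤ w → 0 < K → 0 < η → 0 ≤ θmax →
    (∀ i, Measurable (W i)) → (∀ i, Measurable (ϑ i)) →
    (∀ i, IntervalIntegrable (fun r => ‖W i r‖ ^ 3) volume s (s + w)) →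
    (∀ i r, |ϑ i r| ≤ θmax) → (∀ i, ‖β i‖ ≤ B) →
      (let Q := fun (i : Fin n) (r : ℝ) => if K < ‖W i r‖ then (‖W i r‖ ^ 2 - 5 * ϑ i r) • W i r else (0 : V3)
       |∑ i, inner ℝ (β i) (∫ r in s..(s + w), Q i r)| ≤
         B * (η * (∑ i, ∫ r in s..(s + w), ‖W i r‖ ^ 3) +
           (1 + 5 * θmax / K ^ 2) * ∑ i,
             (if η * ∫ r in s..(s + w), ‖W i r‖ ^ 3 < ‖∫ r in s..(s + w), Q i r‖ then
               ∫ r in s..(s + w), (if K < ‖W i r‖ then ‖W i r‖ ^ 3 else 0) else 0)))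

/-- Pointwise domination of the suprathermal flux signal: if `K < ‖W‖`, `|ϑ| ≤ θmax`, `K > 0` then
`‖(‖W‖² − 5ϑ)W‖ ≤ (1 + 5θmax/K²)‖W‖³` (because `5|ϑ|‖W‖ ≤ (5θmax/K²)‖W‖³`). [folklore] -/
theorem norm_flux_le {K θmax : ℝ} (hK : 0 < K) {Wv : V3} (hW : K < ‖Wv‖) {t : ℝ} (ht : |t| ≤ θmax) :
    ‖(‖Wv‖ ^ 2 - 5 * t) • Wv‖ ≤ (1 + 5 * θmax / K ^ 2) * ‖Wv‖ ^ 3 := by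
  have hθ0 : 0 ≤ θmax := (abs_nonneg t).trans ht
  rw [norm_smul, Real.norm_eq_abs]
  have h1 : |‖Wv‖ ^ 2 - 5 * t| ≤ ‖Wv‖ ^ 2 + 5 * θmax := by
    obtain ⟨htl, htu⟩ := abs_le.1 ht
    rw [abs_le]
    constructor <;> nlinarith [sq_nonneg ‖Wv‖]
  have hK2 : K ^ 2 ≤ ‖Wv‖ ^ 2 := by gcongr
  have hK2pos : 0 < K ^ 2 := by positivity
  have h2 : 5 * θmax * ‖Wv‖ ≤ 5 * θmax / K ^ 2 * ‖Wv‖ ^ 3 := by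
    rw [div_mul_eq_mul_div, le_div_iff₀ hK2pos]
    calc 5 * θmax * ‖Wv‖ * K ^ 2 ≤ 5 * θmax * ‖Wv‖ * ‖Wv‖ ^ 2 :=
          mul_le_mul_of_nonneg_left hK2 (by positivity)
      _ = 5 * θmax * ‖Wv‖ ^ 3 := by ring
  calc |‖Wv‖ ^ 2 - 5 * t| * ‖Wv‖ ≤ (‖Wv‖ ^ 2 + 5 * θmax) * ‖Wv‖ :=
        mul_le_mul_of_nonneg_right h1 (norm_nonneg _)
    _ = ‖Wv‖ ^ 3 + 5 * θmax * ‖Wv‖ := by ring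
    _ ≤ ‖Wv‖ ^ 3 + 5 * θmax / K ^ 2 * ‖Wv‖ ^ 3 := by linarith
    _ = (1 + 5 * θmax / K ^ 2) * ‖Wv‖ ^ 3 := by ring

/-- **One signal.** With `Q(r) = 1{K<‖W r‖}(‖W r‖² − 5ϑ r) W r` measurable and dominated by `C‖W‖³`,
`C = 1 + 5θmax/K²`, on `[s, s+w]`:
`‖∫ Q‖ ≤ η ∫‖W‖³ + C · (if η ∫‖W‖³ < ‖∫ Q‖ then ∫ 1{K<‖W‖}‖W‖³ else 0)`. [folklore] -/
theorem norm_integral_flux_le {s w K η θmax : ℝ} (hw : 0 ≤ w) (hK : 0 < K) (hη : 0 < η) (hθ : 0 ≤ θmax)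
    {Wf : ℝ → V3} {ϑf : ℝ → ℝ} (hWm : Measurable Wf) (hϑm : Measurable ϑf)
    (hint : IntervalIntegrable (fun r => ‖Wf r‖ ^ 3) volume s (s + w)) (hϑ : ∀ r, |ϑf r| ≤ θmax) :
    ‖∫ r in s..(s + w), (if K < ‖Wf r‖ then (‖Wf r‖ ^ 2 - 5 * ϑf r) • Wf r else (0 : V3))‖ ≤
      η * (∫ r in s..(s + w), ‖Wf r‖ ^ 3) +
        (1 + 5 * θmax / K ^ 2) *
          (if η * ∫ r in s..(s + w), ‖Wf r‖ ^ 3 <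
              ‖∫ r in s..(s + w), (if K < ‖Wf r‖ then (‖Wf r‖ ^ 2 - 5 * ϑf r) • Wf r else (0 : V3))‖ then
            ∫ r in s..(s + w), (if K < ‖Wf r‖ then ‖Wf r‖ ^ 3 else 0) else 0) := by
  set C : ℝ := 1 + 5 * θmax / K ^ 2 with hC
  have hC0 : 0 ≤ C := by rw [hC]; positivity
  have hsw : s ≤ s + w := by linarith
  set Q : ℝ → V3 := fun r => if K < ‖Wf r‖ then (‖Wf r‖ ^ 2 - 5 * ϑf r) • Wf r else 0 with hQ
  set hi : ℝ → ℝ := fun r => if K < ‖Wf r‖ then ‖Wf r‖ ^ 3 else 0 with hhi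
  -- measurability
  have hset : MeasurableSet {r | K < ‖Wf r‖} := measurableSet_lt measurable_const hWm.norm
  have hQm : Measurable Q := by
    refine Measurable.ite hset ?_ measurable_const
    exact ((hWm.norm.pow_const 2).sub (measurable_const.mul hϑm)).smul hWm
  have hhim : Measurable hi := Measurable.ite hset (hWm.norm.pow_const 3) measurable_const
  -- pointwise bounds
  have hQle : ∀ r, ‖Q r‖ ≤ C * hi r := by
    intro r
    simp only [hQ, hhi]
    split_ifs with h
    · exact norm_flux_le hK h (hϑ r)
    · simp
  have hhile : ∀ r, |hi r| ≤ ‖Wf r‖ ^ 3 := by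
    intro r
    simp only [hhi]
    split_ifs
    · rw [abs_of_nonneg (by positivity)]
    · rw [abs_zero]; positivity
  have hhi0 : ∀ r, 0 ≤ hi r := fun r => by simp only [hhi]; split_ifs <;> positivity
  -- integrability by domination
  have hhiint : IntervalIntegrable hi volume s (s + w) := by
    refine hint.mono_fun hhim.aestronglyMeasurable (Eventually.of_forall fun r => ?_)
    show ‖hi r‖ ≤ ‖‖Wf r‖ ^ 3‖
    rw [Real.norm_eq_abs, Real.norm_eq_abs, abs_of_nonneg (by positivity : (0 : ℝ) ≤ ‖Wf r‖ ^ 3)]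
    exact hhile r
  have hCint : IntervalIntegrable (fun r => C * hi r) volume s (s + w) := hhiint.const_mul C
  have hQint : IntervalIntegrable (fun r => ‖Q r‖) volume s (s + w) := by
    refine hCint.mono_fun hQm.norm.aestronglyMeasurable (Eventually.of_forall fun r => ?_)
    show ‖‖Q r‖‖ ≤ ‖C * hi r‖
    rw [norm_norm, Real.norm_eq_abs, abs_of_nonneg (mul_nonneg hC0 (hhi0 r))]
    exact hQle r
  -- nonnegativity of the cubic content
  have hI3 : 0 ≤ ∫ r in s..(s + w), ‖Wf r‖ ^ 3 :=
    intervalIntegral.integral_nonneg hsw fun r _ => by positivity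
  -- the case split
  have h1 : ‖∫ r in s..(s + w), Q r‖ ≤ ∫ r in s..(s + w), ‖Q r‖ :=
    intervalIntegral.norm_integral_le_integral_norm hsw
  have h2 : ∫ r in s..(s + w), ‖Q r‖ ≤ ∫ r in s..(s + w), C * hi r :=
    intervalIntegral.integral_mono_on hsw hQint hCint fun r _ => hQle r
  rw [intervalIntegral.integral_const_mul] at h2
  have h3 : 0 ≤ η * ∫ r in s..(s + w), ‖Wf r‖ ^ 3 := mul_nonneg hη.le hI3
  show ‖∫ r in s..(s + w), Q r‖ ≤ η * (∫ r in s..(s + w), ‖Wf r‖ ^ 3) +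
    C * (if η * ∫ r in s..(s + w), ‖Wf r‖ ^ 3 < ‖∫ r in s..(s + w), Q r‖ then
      ∫ r in s..(s + w), hi r else 0)
  by_cases hcoh : η * ∫ r in s..(s + w), ‖Wf r‖ ^ 3 < ‖∫ r in s..(s + w), Q r‖
  · rw [if_pos hcoh]
    linarith
  · rw [if_neg hcoh, mul_zero, add_zero]
    exact not_lt.1 hcoh

/-- **STUB S12 `stub_hiHeatFluxSplit`** of line `IdeatorTwoSketch` (crux `ClampedCurrentsDock`, stmt-14680). -/
theorem stub_hiHeatFluxSplit : HiHeatFluxSplit := by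
  intro n s w K η θmax B W ϑ β hw hK hη hθ hWm hϑm hint hϑ hβ
  simp only
  set C : ℝ := 1 + 5 * θmax / K ^ 2 with hC
  -- termwise bound
  have hterm : ∀ i, |inner ℝ (β i) (∫ r in s..(s + w),
      (if K < ‖W i r‖ then (‖W i r‖ ^ 2 - 5 * ϑ i r) • W i r else (0 : V3)))| ≤
      B * (η * (∫ r in s..(s + w), ‖W i r‖ ^ 3) +
        C * (if η * ∫ r in s..(s + w), ‖W i r‖ ^ 3 <
              ‖∫ r in s..(s + w), (if K < ‖W i r‖ then (‖W i r‖ ^ 2 - 5 * ϑ i r) • W i r else (0 : V3))‖ then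
            ∫ r in s..(s + w), (if K < ‖W i r‖ then ‖W i r‖ ^ 3 else 0) else 0)) := by
    intro i
    have hcs := abs_real_inner_le_norm (β i) (∫ r in s..(s + w),
      (if K < ‖W i r‖ then (‖W i r‖ ^ 2 - 5 * ϑ i r) • W i r else (0 : V3)))
    have hone := norm_integral_flux_le (η := η) hw hK hη hθ (hWm i) (hϑm i) (hint i) (hϑ i)
    calc _ ≤ ‖β i‖ * ‖∫ r in s..(s + w),
          (if K < ‖W i r‖ then (‖W i r‖ ^ 2 - 5 * ϑ i r) • W i r else (0 : V3))‖ := hcs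
      _ ≤ B * ‖∫ r in s..(s + w),
          (if K < ‖W i r‖ then (‖W i r‖ ^ 2 - 5 * ϑ i r) • W i r else (0 : V3))‖ :=
          mul_le_mul_of_nonneg_right (hβ i) (norm_nonneg _)
      _ ≤ _ := mul_le_mul_of_nonneg_left hone ((norm_nonneg _).trans (hβ i))
  calc |∑ i, inner ℝ (β i) (∫ r in s..(s + w),
        (if K < ‖W i r‖ then (‖W i r‖ ^ 2 - 5 * ϑ i r) • W i r else (0 : V3)))|
      ≤ ∑ i, |inner ℝ (β i) (∫ r in s..(s + w),
        (if K < ‖W i r‖ then (‖W i r‖ ^ 2 - 5 * ϑ i r) • W i r else (0 : V3)))| :=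
        Finset.abs_sum_le_sum_abs _ _
    _ ≤ ∑ i, B * (η * (∫ r in s..(s + w), ‖W i r‖ ^ 3) +
        C * (if η * ∫ r in s..(s + w), ‖W i r‖ ^ 3 <
              ‖∫ r in s..(s + w), (if K < ‖W i r‖ then (‖W i r‖ ^ 2 - 5 * ϑ i r) • W i r else (0 : V3))‖ then
            ∫ r in s..(s + w), (if K < ‖W i r‖ then ‖W i r‖ ^ 3 else 0) else 0)) :=
        Finset.sum_le_sum fun i _ => hterm i
    _ = B * (η * (∑ i, ∫ r in s..(s + w), ‖W i r‖ ^ 3) +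
          C * ∑ i, (if η * ∫ r in s..(s + w), ‖W i r‖ ^ 3 <
              ‖∫ r in s..(s + w), (if K < ‖W i r‖ then (‖W i r‖ ^ 2 - 5 * ϑ i r) • W i r else (0 : V3))‖ then
            ∫ r in s..(s + w), (if K < ‖W i r‖ then ‖W i r‖ ^ 3 else 0) else 0)) := by
        rw [Finset.mul_sum, Finset.mul_sum, ← Finset.sum_add_distrib, Finset.mul_sum]

end Summit.AtomisticToContinuum.HydrodynamicLimit.Theorems.ClampedCurrentsDockHiSplit

end
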